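import Summits.HodgeConjecture.HodgeCM.PerL34.GenuineSchrodingerSchwartzBox_1

/-! PORT of `HodgeCM/PerL34/GenuineSchrodingerSchwartzBox.lean` (HodgeCMPerL run 82) — part 2: continuation of `Summits.HodgeConjecture.HodgeCM.PerL34.GenuineSchrodingerSchwartzBox_1` (split at a top-level declaration boundary by port_pkg.py; scope re-opened below; declarations unchanged). -/

-- port_pkg: scope re-opened for this part (file-level context, then the namespace/section stack open at the cut)
set_option autoImplicit false
noncomputable section
open MeasureTheory MeasureTheory.Measure Set Metric Function Complex Topology Filter
open scoped RestrictedProduct InnerProductSpace NNReal ENNReal Pointwise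
namespace HodgeCM.PerL34.PureTensor.SchrodingerModel
open HodgeCM.PerL34.LocalFactors HodgeCM.PerL34.LocalFactors.DilationModel
open HodgeCM.PerL34.IdelePlaces NumberField IsDedekindDomain
attribute [local instance] LocalFactors.DilationModel.Adic.nontriviallyNormedField
  LocalFactors.DilationModel.Adic.properSpace
variable {L : Type} [Field L] [NumberField L] [IsCMField L]
namespace Coeff
/-- consumer form: every vector of `𝒮(X)` — in particular every `φ` fed to the S3 END through
`…_genuine_schwartzEmbed` — is a finite `ℂ`-combination of indicator vectors of factorizable boxes -/
theorem mem_span_indRBox_of_mem_schwartzBruhat {f : Lp ℂ 2 (μ L)} (hf : f ∈ schwartzBruhat L) :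
    f ∈ Submodule.span ℂ (Set.range (indRBox L)) := by
  rwa [← schwartzBruhat_eq_span_indRBox]

/-- the distinguished vector `φ_e = 1_{boxE}` of the S3 END is itself the indicator vector of a
factorizable box: `φ_e ∈ span {1_{∏ C_v}}` -/
theorem phiE_mem_span_indRBox
    [∀ v : HeightOneSpectrum (𝓞 (maximalRealSubfield L)), MeasurableSpace (v.adicCompletion (maximalRealSubfield L))]
    [∀ v : HeightOneSpectrum (𝓞 (maximalRealSubfield L)), BorelSpace (v.adicCompletion (maximalRealSubfield L))]
    [DecidableEq (Place (maximalRealSubfield L))] (e : Space L) :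
    phiE e ∈ Submodule.span ℂ (Set.range (indRBox L)) :=
  mem_span_indRBox_of_mem_schwartzBruhat (phiE_mem_schwartzBruhat e)

end Coeff

end HodgeCM.PerL34.PureTensor.SchrodingerModel

end
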